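import Summits.AnomalousDissipation.AnomalousDissipation.Theses.PumpedMirror
import Summits.AnomalousDissipation.AnomalousDissipation.Theorems.PumpedMirrorMirrorBoundedFromRestTGStubMirrorSchemeFromRest
import Summits.AnomalousDissipation.AnomalousDissipation.Theorems.PumpedMirrorMirrorBoundedFromRestTGStubLimitInheritsMirrorBound
import Summits.AnomalousDissipation.AnomalousDissipation.Theorems.PumpedMirrorMirrorBoundedFromRestTGTransient
import Summits.AnomalousDissipation.AnomalousDissipation.Theorems.TaylorGreenLoudGalerkinStates.Negative.Anatomy
import Summits.AnomalousDissipation.AnomalousDissipation.Theorems.TaylorCertificatesZeroDatumLerayHopf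
import Literature.Analysis.FluidPDE.DoeringFoiasProofs
import Literature.Analysis.FluidPDE.DoeringFoiasPowerProofs
import Literature.Analysis.FluidPDE.DoeringFoiasAmplitudeProofs
import Literature.Analysis.FluidPDE.AlexakisDoeringProofs
import Literature.Analysis.FluidPDE.TorusForceBookkeeping
import Literature.Analysis.FluidPDE.LongTimeAverageSubadditive
import Literature.Analysis.FluidPDE.LongTimeAverageSlidingWindow
import Literature.Analysis.FluidPDE.LerayHopfUniformEnergy
import Literature.Analysis.FluidPDE.NSHopfGalerkinLimit

/-!
# STRATEGY CENSUS — typed companion (crux `MirrorEnsemble.MirrorMeanBoundedFamilyTG` = B_K, stmt-AnomalousDissipation-17694)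

Crux-dir copy WITHOUT the route-file import (B_K and X_K restated byte-identically; see the docstring of `B`).

Crux-strategist seat `planner-cstrat-stmt-AnomalousDissipation-17694-b1-0` (2026-08-17, before any lead).  Prose lives in
`STRATEGY-CENSUS.md`; this file TYPES the census' attempts and PROVES the cheap implications between them, so that
every "no leverage" / "same kernel" claim points at a kernel-checked statement.  Nothing here closes the item.
`sorry`-free.

* §0 `crux_iff` — B_K unfolded at `tgForce`; `IsKFamily` = its frame (viscosities `> 0` tending to `0`, global
  Leray–Hopf paths of NS_{ν_j}(f_TG), `H`-valued lifts, coordinatewise `K`-symmetry of the lifts a.e.).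
* §1 `crux_of_target` — B_K is the NECESSARY half of the route's target X_K (projection).
* §2 `crux_of_pathwise` — PumpedMirror's crux `MirrorBoundedFromRestTG` (stmt-15373, PATHWISE ceiling from rest,
  staffed, lead c1 live) IMPLIES B_K: the strengthening with a live line elsewhere.
* §3 `mirrorLhFromRest_holds` — for EVERY `ν > 0` a global Leray–Hopf solution of NS_ν(f_TG) FROM REST with an
  `H`-lift that is `K`-symmetric a.e. EXISTS (PumpedMirror's landed stub A + the landed limit passage of stub C
  without its bound): the birth line's first stub `StubMirrorLhFromRestTG` is a theorem; `perViscosity_ceiling`,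
  `withoutVanishing_holds` — dropping `ν_j → 0` makes B_K a theorem (the whole content is ν-UNIFORMITY).
* §4 STRENGTHEN — `MirrorMeanCeilingFromRestTG` (birth line content, ∀ rest paths) → B_K; `MirrorMeanCeilingAllDataTG`
  (trajectory-blind ceiling) → the former; `RelativeFloorFamilyTG c` → B_K (`E = 1/(4c²)`), and with a level floor
  → X_K (summit-strength in the arena).
* §5 DECOMPOSITION — (a) ensemble mean split in Fix K, glue proved; (b) THE GALERKIN–CESÀRO REDUCTION
  `crux_of_galerkinCesaro : CesaroBoundPassesToMirrorLimitTG → GalerkinCesaroCeilingFromRestTG → B_K` over the LANDED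
  `stub_mirrorSchemeFromRest` — the weakest finite-dimensional sufficient form (registration-ready, NOT registered);
  (c) `galerkinCesaro_of_pathwiseLate` — PumpedMirror's open stub B′₂ (+ its landed transient B′₁) implies the
  Cesàro ceiling: B_K rides on the line already staffed for stmt-15373.
* §6 NEGATION — `restFamilyDiverges_of_not_crux : ¬B_K → RestFamilyDivergesTG`.
-/

noncomputable section

-- `Summit.<Summit>.<Problem>` repeats the summit segment by the D-0017 layout.
set_option linter.dupNamespace false

open scoped BigOperators Topology ENNReal
open MeasureTheory Set Filter Function UnitAddTorus
open Literature.Analysis.FunctionSpaces Literature.Analysis.FunctionSpaces.Torus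
open Literature.Analysis.FluidPDE Literature.Analysis.FluidPDE.Torus

namespace Summit.AnomalousDissipation.AnomalousDissipation.Cruxes.MirrorMeanBoundedFamilyTG.StrategyCensus

open Summit.AnomalousDissipation.AnomalousDissipation.Theorems
open Summit.AnomalousDissipation.AnomalousDissipation.Theorems.TaylorGreenLoudGalerkinStates
open Summit.AnomalousDissipation.AnomalousDissipation.Theorems.TaylorGreenLoudGalerkinStates.Negative
open Summit.AnomalousDissipation.AnomalousDissipation.Theorems.TaylorGreenLoudGalerkinStates.TgForceRegular
open Summit.AnomalousDissipation.AnomalousDissipation.Theorems.TaylorGreenLoudGalerkinStates.Criticality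
open Summit.AnomalousDissipation.AnomalousDissipation.Theorems.PumpedMirror.MirrorBoundedFromRestTG.SchemeFromRest
open Summit.AnomalousDissipation.AnomalousDissipation.Theorems.PumpedMirror.MirrorBoundedFromRestTG.LimitInherits

/-! ## §0 The crux and its frame -/

/-- The crux B_K (item stmt-AnomalousDissipation-17694), body BYTE-IDENTICAL to the route decl
`Summit.AnomalousDissipation.AnomalousDissipation.Theses.MirrorEnsemble.MirrorMeanBoundedFamilyTG`
(`B ↔ MirrorEnsemble.MirrorMeanBoundedFamilyTG := Iff.rfl`, checked rc 0 in the evidence copy `CensusSketch.lean`, which imports the route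
file; this crux-dir copy restates it because the farm reported `Theses.MirrorEnsemble` incoherent at publish time). -/
abbrev B : Prop :=
  ∀ f : UnitAddTorus (Fin 3) → EuclideanSpace ℝ (Fin 3), f = (fun x => !₂[(fourier 1 (x 0) : ℂ).im * (fourier 1 (x 1) : ℂ).re * (fourier 1 (x 2) : ℂ).re, -((fourier 1 (x 0) : ℂ).re * (fourier 1 (x 1) : ℂ).im * (fourier 1 (x 2) : ℂ).re), (0 : ℝ)]) → ∃ (E : ℝ) (ν : ℕ → ℝ) (u₀ : ℕ → UnitAddTorus (Fin 3) → EuclideanSpace ℝ (Fin 3)) (u : ℕ → ℝ → UnitAddTorus (Fin 3) → EuclideanSpace ℝ (Fin 3)) (U : ℕ → ℝ → Literature.Analysis.FunctionSpaces.Torus.energySpace (Fin 3)), (∀ j, 0 < ν j) ∧ Filter.Tendsto ν Filter.atTop (nhds 0) ∧ (∀ j, Literature.Analysis.FluidPDE.Torus.IsGlobalLerayHopf (ν j) (fun _ => f) (u₀ j) (u j)) ∧ (∀ j t, 0 ≤ t → ((U j t : MeasureTheory.Lp (EuclideanSpace ℝ (Fin 3)) 2 (MeasureTheory.volume : MeasureTheory.Measure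 (UnitAddTorus (Fin 3)))) : UnitAddTorus (Fin 3) → EuclideanSpace ℝ (Fin 3)) =ᵐ[MeasureTheory.volume] u j t) ∧ (∀ j t, 0 ≤ t → ∀ i i' : Fin 3, (fun x => ((U j t : MeasureTheory.Lp (EuclideanSpace ℝ (Fin 3)) 2 (MeasureTheory.volume : MeasureTheory.Measure (UnitAddTorus (Fin 3)))) : UnitAddTorus (Fin 3) → EuclideanSpace ℝ (Fin 3)) (Function.update x i (-x i)) i') =ᵐ[MeasureTheory.volume] (fun x => if i' = i then -(((U j t : MeasureTheory.Lp (EuclideanSpace ℝ (Fin 3)) 2 (MeasureTheory.volume : MeasureTheory.Measure (UnitAddTorus (Fin 3)))) : UnitAddTorus (Fin 3) → EuclideanSpace ℝ (Fin 3)) x i') else ((U j t : MeasureTheory.Lp (EuclideanSpace ℝ (Fin 3)) 2 (MeasureTheory.volume : MeasureTheory.Measure (UnitAddTorus (Fin 3)))) : UnitAddTorus (Fin 3) → EuclideanSpace ℝ (Fin 3)) x i')) ∧ ∀ j, Literature.Analysis.FluidPDE.meanEnergy (u j) ≤ E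

/-- The route's target X_K (item stmt-AnomalousDissipation-17692), body byte-identical to
`…Theses.MirrorEnsemble.MirrorMeanZerothLawTG` (`Iff.rfl` in the evidence copy). -/
abbrev X : Prop :=
  ∀ f : UnitAddTorus (Fin 3) → EuclideanSpace ℝ (Fin 3), f = (fun x => !₂[(fourier 1 (x 0) : ℂ).im * (fourier 1 (x 1) : ℂ).re * (fourier 1 (x 2) : ℂ).re, -((fourier 1 (x 0) : ℂ).re * (fourier 1 (x 1) : ℂ).im * (fourier 1 (x 2) : ℂ).re), (0 : ℝ)]) → ∃ (E ε : ℝ), 0 < ε ∧ ∃ (ν : ℕ → ℝ) (u₀ : ℕ → UnitAddTorus (Fin 3) → EuclideanSpace ℝ (Fin 3)) (u : ℕ → ℝ → UnitAddTorus (Fin 3) → EuclideanSpace ℝ (Fin 3)) (U : ℕ → ℝ → Literature.Analysis.FunctionSpaces.Torus.energySpace (Fin 3)), (∀ j, 0 < ν j) ∧ Filter.Tendsto ν Filter.atTop (nhds 0) ∧ (∀ j, Literature.Analysis.FluidPDE.Torus.IsGlobalLerayHopf (ν j) (fun _ => f) (u₀ j) (u j)) ∧ (∀ j t, 0 ≤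 t → ((U j t : MeasureTheory.Lp (EuclideanSpace ℝ (Fin 3)) 2 (MeasureTheory.volume : MeasureTheory.Measure (UnitAddTorus (Fin 3)))) : UnitAddTorus (Fin 3) → EuclideanSpace ℝ (Fin 3)) =ᵐ[MeasureTheory.volume] u j t) ∧ (∀ j t, 0 ≤ t → ∀ i i' : Fin 3, (fun x => ((U j t : MeasureTheory.Lp (EuclideanSpace ℝ (Fin 3)) 2 (MeasureTheory.volume : MeasureTheory.Measure (UnitAddTorus (Fin 3)))) : UnitAddTorus (Fin 3) → EuclideanSpace ℝ (Fin 3)) (Function.update x i (-x i)) i') =ᵐ[MeasureTheory.volume] (fun x => if i' = i then -(((U j t : MeasureTheory.Lp (EuclideanSpace ℝ (Fin 3)) 2 (MeasureTheory.volume : MeasureTheory.Measure (UnitAddTorus (Fin 3)))) : UnitAddTorus (Fin 3) → EuclideanSpace ℝ (Fin 3)) x i') else ((U j t : MeasureTheory.Lp (EuclideanSpace ℝ (Fin 3)) 2 (MeasureTheory.volume : MeasureTheory.Measure (UnitAddTorus (Fin 3)))) : UnitAddTorus (Fin 3) → EuclideanSpace ℝ (Fin 3)) x i')) ∧ (∀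 j, Literature.Analysis.FluidPDE.meanEnergy (u j) ≤ E) ∧ ∀ j, ε ≤ Literature.Analysis.FluidPDE.meanDissipation (ν j) (u j)

/-- PumpedMirror's crux #3 (item stmt-AnomalousDissipation-15373): the PATHWISE ν-uniform ceiling from rest in Fix K. -/
abbrev Bpath : Prop := Summit.AnomalousDissipation.AnomalousDissipation.Theses.PumpedMirror.MirrorBoundedFromRestTG

/-- The pinned Taylor–Green force of the route decls is `Negative.tgForce` (definitional). -/
theorem tgForce_eq : tgForce = (fun x : UnitAddTorus (Fin 3) => !₂[(fourier 1 (x 0) : ℂ).im * (fourier 1 (x 1) : ℂ).re * (fourier 1 (x 2) : ℂ).re, -((fourier 1 (x 0) : ℂ).re * (fourier 1 (x 1) : ℂ).im * (fourier 1 (x 2) : ℂ).re), (0 : ℝ)]) :=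
  rfl

/-- The `H`-lift clause for one path. -/
def IsLift (u : ℝ → UnitAddTorus (Fin 3) → EuclideanSpace ℝ (Fin 3)) (U : ℝ → energySpace (Fin 3)) : Prop :=
  ∀ t, 0 ≤ t → ((U t : Lp (EuclideanSpace ℝ (Fin 3)) 2 (volume : Measure (UnitAddTorus (Fin 3)))) :
    UnitAddTorus (Fin 3) → EuclideanSpace ℝ (Fin 3)) =ᵐ[volume] u t

/-- The coordinatewise `K`-symmetry clause of the lift (a.e., every `t ≥ 0`). -/
def IsKSymmLift (U : ℝ → energySpace (Fin 3)) : Prop :=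
  ∀ t, 0 ≤ t → ∀ i i' : Fin 3, (fun x => ((U t : Lp (EuclideanSpace ℝ (Fin 3)) 2 (volume : Measure (UnitAddTorus (Fin 3)))) :
      UnitAddTorus (Fin 3) → EuclideanSpace ℝ (Fin 3)) (Function.update x i (-x i)) i') =ᵐ[volume]
    (fun x => if i' = i then -(((U t : Lp (EuclideanSpace ℝ (Fin 3)) 2 (volume : Measure (UnitAddTorus (Fin 3)))) :
      UnitAddTorus (Fin 3) → EuclideanSpace ℝ (Fin 3)) x i') else ((U t : Lp (EuclideanSpace ℝ (Fin 3)) 2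
        (volume : Measure (UnitAddTorus (Fin 3)))) : UnitAddTorus (Fin 3) → EuclideanSpace ℝ (Fin 3)) x i')

/-- The FRAME of B_K: positive viscosities tending to `0`, global Leray–Hopf solutions of NS_{ν_j}(f_TG) from data
`u₀ⱼ`, `H`-lifts, `K`-symmetric a.e. -/
def IsKFamily (ν : ℕ → ℝ) (u₀ : ℕ → UnitAddTorus (Fin 3) → EuclideanSpace ℝ (Fin 3))
    (u : ℕ → ℝ → UnitAddTorus (Fin 3) → EuclideanSpace ℝ (Fin 3)) (U : ℕ → ℝ → energySpace (Fin 3)) : Prop :=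
  (∀ j, 0 < ν j) ∧ Tendsto ν atTop (nhds 0) ∧
    (∀ j, IsGlobalLerayHopf (ν j) (fun _ => tgForce) (u₀ j) (u j)) ∧ (∀ j, IsLift (u j) (U j)) ∧ ∀ j, IsKSymmLift (U j)

/-- **The crux unfolded**: `B_K ↔` some `K`-family has ν-uniformly bounded limsup-mean energy. -/
theorem crux_iff : B ↔ ∃ (E : ℝ) (ν : ℕ → ℝ) (u₀ : ℕ → UnitAddTorus (Fin 3) → EuclideanSpace ℝ (Fin 3))
    (u : ℕ → ℝ → UnitAddTorus (Fin 3) → EuclideanSpace ℝ (Fin 3)) (U : ℕ → ℝ → energySpace (Fin 3)),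
    IsKFamily ν u₀ u U ∧ ∀ j, meanEnergy (u j) ≤ E := by
  constructor
  · intro h
    obtain ⟨E, ν, u₀, u, U, hν, hν0, hLH, hU, hK, hE⟩ := h tgForce tgForce_eq
    exact ⟨E, ν, u₀, u, U, ⟨hν, hν0, hLH, hU, hK⟩, hE⟩
  · rintro ⟨E, ν, u₀, u, U, ⟨hν, hν0, hLH, hU, hK⟩, hE⟩ f hf
    have hfg : f = tgForce := hf.trans tgForce_eq.symm
    subst hfg
    exact ⟨E, ν, u₀, u, U, hν, hν0, hLH, hU, hK, hE⟩

/-! ## §1 B_K is necessary for the route's target -/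

/-- **X_K → B_K** (projection: forget the dissipation floor). -/
theorem crux_of_target (h : X) : B := by
  intro f hf
  obtain ⟨E, ε, -, ν, u₀, u, U, hν, hν0, hLH, hU, hK, hE, -⟩ := h f hf
  exact ⟨E, ν, u₀, u, U, hν, hν0, hLH, hU, hK, hE⟩

/-! ## §2 Strengthen (i): the PATHWISE ceiling from rest (PumpedMirror #3) implies B_K -/

/-- A pathwise bound on the lift bounds the limsup-mean energy (`‖U t‖² = ∫|u t|²`, Cesàro means `≤ E`). -/
theorem meanEnergy_le_of_lift_bound {u : ℝ → UnitAddTorus (Fin 3) → EuclideanSpace ℝ (Fin 3)}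
    {U : ℝ → energySpace (Fin 3)} {E : ℝ} (hU : IsLift u U) (hb : ∀ t, 0 ≤ t → ‖U t‖ ^ 2 ≤ E) :
    meanEnergy u ≤ E := by
  refine longTimeAvgSup_le_const (fun t => integral_nonneg fun x => sq_nonneg _) fun t ht => ?_
  rw [integral_norm_sq_eq_norm_lift_sq hU ht.le]
  simpa [Submodule.coe_norm] using hb t ht.le

/-- **`MirrorBoundedFromRestTG → B_K`**: along `ν_j = ν₁/(j+2)` the bounded `K`-symmetric rest paths of PumpedMirror's
crux form a mean-bounded `K`-family (datum `0`).  So B_K is implied by a crux that is ALREADY STAFFED (stmt-15373). -/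
theorem crux_of_pathwise (h : Bpath) : B := by
  intro f hf
  obtain ⟨E, ν₁, -, hν₁, hall⟩ := h f hf
  have hνj : ∀ j : ℕ, 0 < ν₁ / ((j : ℝ) + 2) ∧ ν₁ / ((j : ℝ) + 2) < ν₁ := fun j =>
    ⟨by positivity, by
      rw [div_lt_iff₀ (by positivity)]
      nlinarith [(Nat.cast_nonneg j : (0 : ℝ) ≤ j)]⟩
  choose u U hLH hU hK hb using fun j : ℕ => hall (ν₁ / ((j : ℝ) + 2)) (hνj j).1 (hνj j).2
  have hν0 : Tendsto (fun j : ℕ => ν₁ / ((j : ℝ) + 2)) atTop (nhds 0) := by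
    have h1 : Tendsto (fun j : ℕ => ((j : ℝ) + 2)) atTop atTop :=
      tendsto_atTop_add_const_right _ _ tendsto_natCast_atTop_atTop
    simpa using tendsto_const_nhds.div_atTop h1
  exact ⟨E, fun j => ν₁ / ((j : ℝ) + 2), fun _ => 0, u, U, fun j => (hνj j).1, hν0, hLH, hU, hK,
    fun j => meanEnergy_le_of_lift_bound (hU j) (hb j)⟩

/-! ## §3 Per-viscosity facts: the frame is a theorem at each fixed `ν` -/

/-- **K-symmetric Leray–Hopf existence from rest, every `ν > 0`** (the birth line's `StubMirrorLhFromRestTG`, PROVED):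
PumpedMirror's landed stub A (`stub_mirrorSchemeFromRest`: a `K`-symmetric exact-force Hopf–Galerkin scheme from rest)
followed by the landed limit passage of stub C WITHOUT its pathwise bound (limit field along a subsequence,
Leray–Hopf on every `[0,T)`, `H`-lift, mirror relation of the coefficients in the limit). -/
theorem mirrorLhFromRest_holds (ν : ℝ) (hν : 0 < ν) :
    ∃ (u : ℝ → UnitAddTorus (Fin 3) → EuclideanSpace ℝ (Fin 3)) (V : ℝ → energySpace (Fin 3)),
      IsGlobalLerayHopf ν (fun _ => tgForce) 0 u ∧ IsLift u V ∧ IsKSymmLift V := by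
  obtain ⟨N, U, hS, hsym⟩ := stub_mirrorSchemeFromRest tgForce tgForce_eq ν hν
  -- standing data: zero datum, steady smooth force
  have hu₀ : MemLp (0 : UnitAddTorus (Fin 3) → EuclideanSpace ℝ (Fin 3)) 2 volume := MemLp.zero
  have hdiv : IsWeaklyDivFree (0 : UnitAddTorus (Fin 3) → EuclideanSpace ℝ (Fin 3)) := fun θ _ => by simp
  have hfm : AEStronglyMeasurable (stLift (fun _ : ℝ => tgForce)) (volume.restrict (Ioi 0 ×ˢ univ)) :=
    aestronglyMeasurable_stLift_const isSmooth_tgForce _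
  have hf₂ : ∀ T : ℝ, 0 < T → ∫⁻ _ in Ioo 0 T, ∫⁻ x, ‖tgForce x‖ₑ ^ 2 < ⊤ := fun T _ =>
    lintegral_enorm_sq_const_lt_top isSmooth_tgForce T
  obtain ⟨φ, hφ, u, hum, hu, hc⟩ := hS.exists_limitField hν.le hu₀ hfm hf₂
  have hS' := hS.comp_strictMono hφ
  have hLH : IsGlobalLerayHopf ν (fun _ => tgForce) 0 u := fun T hT =>
    hS'.isLerayHopfOn_limit hν hu₀ hdiv hfm hf₂ hum hu hc hT
  obtain ⟨V, hV⟩ := exists_energySpace_lift_of_isGlobalLerayHopf_zero isSmooth_tgForce hasZeroMean_tgForce hLH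
  set R : Fin 3 → (EuclideanSpace ℂ (Fin 3) →L[ℂ] EuclideanSpace ℂ (Fin 3)) :=
    fun i => Matrix.toEuclideanCLM (n := Fin 3) (𝕜 := ℂ) ((reflMat i).map (Int.cast : ℤ → ℂ)) with hR_def
  have hR : ∀ (i : Fin 3) (v : EuclideanSpace ℂ (Fin 3)) (j : Fin 3), R i v j = if j = i then -v j else v j :=
    fun i v j => toEuclideanCLM_reflMat_apply i v j
  have hcoefU : ∀ (n : ℕ) (t : ℝ), 0 ≤ t → ∀ (i : Fin 3) (k : Fin 3 → ℤ),
      mFourierCoeff (EuclideanSpace.complexify ∘ U n t) (Matrix.vecMul k (reflMat i)) =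
        R i (mFourierCoeff (EuclideanSpace.complexify ∘ U n t) k) := fun n t ht i k =>
    mFourierCoeff_mirror_of_isKSymm hR (hS.continuous_slice n ht) (isKSymm_of_coord (hsym n t ht)) i k
  have hcoefu : ∀ (t : ℝ), 0 ≤ t → ∀ (i : Fin 3) (k : Fin 3 → ℤ),
      mFourierCoeff (EuclideanSpace.complexify ∘ u t) (Matrix.vecMul k (reflMat i)) =
        R i (mFourierCoeff (EuclideanSpace.complexify ∘ u t) k) := fun t ht i k =>
    mirror_coeff_of_tendsto (c := fun j k => mFourierCoeff (EuclideanSpace.complexify ∘ U (φ j) t) k) (R i)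
      (hc t ht) (fun j k => hcoefU (φ j) t ht i k) k
  have hae : ∀ (t : ℝ), 0 ≤ t → ∀ i : Fin 3,
      (fun x => u t (mulVecT (reflMat i) x)) =ᵐ[volume] fun x => actVec (reflMat i) (u t x) := fun t ht i =>
    ae_mirror_of_mFourierCoeff_mirror (hu t ht) i (hcoefu t ht i)
  refine ⟨u, V, hLH, hV, fun t ht i j => ?_⟩
  have hdet : (reflMat i).det ≠ 0 := Matrix.det_ne_zero_of_left_inverse (reflMat_mul_self i)
  have h1 := (measurePreserving_mulVecT hdet).quasiMeasurePreserving.ae_eq_comp (hV t ht)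
  have h3 := (hV t ht).symm.fun_comp (actVec (reflMat i))
  filter_upwards [h1, hae t ht i, h3] with x hx1 hx2 hx3
  simp only [Function.comp_apply] at hx1 hx3
  rw [update_neg_eq_mulVecT, hx1, hx2, hx3, actVec_reflMat_apply]

/-- **Per-viscosity ceiling (in tree, FMRT IV (3.2)).** For every `ν > 0` the `K`-symmetric Leray–Hopf solution of
NS_ν(f_TG) from rest of `mirrorLhFromRest_holds` has `meanEnergy ≤ 2/ν²` (Leray ball `max(2|u₀|², 4‖f‖²/ν²) + 4‖f‖²/ν²`
with `u₀ = 0`, `‖f_TG‖₂² = 1/4`).  This is the NON-uniform bound the crux must beat. -/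
theorem perViscosity_ceiling (ν : ℝ) (hν : 0 < ν) :
    ∃ (u : ℝ → UnitAddTorus (Fin 3) → EuclideanSpace ℝ (Fin 3)) (V : ℝ → energySpace (Fin 3)),
      IsGlobalLerayHopf ν (fun _ => tgForce) 0 u ∧ IsLift u V ∧ IsKSymmLift V ∧ meanEnergy u ≤ 2 / ν ^ 2 := by
  obtain ⟨u, V, hu, hV, hK⟩ := mirrorLhFromRest_holds ν hν
  refine ⟨u, V, hu, hV, hK, ?_⟩
  refine longTimeAvgSup_le_const (fun t => integral_nonneg fun x => sq_nonneg _) fun t ht => ?_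
  have hball := integral_norm_sq_le_of_isGlobalLerayHopf hν (isSmooth_tgForce.memLp 2) hu hV ht.le
  have hkin0 : kineticEnergy (0 : UnitAddTorus (Fin 3) → EuclideanSpace ℝ (Fin 3)) = 0 := by
    simp [kineticEnergy]
  rw [hkin0, mul_zero, integral_norm_sq_tgForce] at hball
  have hC0 : (0 : ℝ) ≤ 4⁻¹ / ν * (4 / ν) := by positivity
  rw [max_eq_right hC0] at hball
  have hid : (4⁻¹ : ℝ) / ν * (4 / ν) + 4⁻¹ / ν * (4 / ν) = 2 / ν ^ 2 := by
    field_simp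
    ring
  linarith

/-- B_K with the clause `ν_j → 0` DROPPED. -/
def BWithoutVanishing : Prop :=
  ∃ (E : ℝ) (ν : ℕ → ℝ) (u₀ : ℕ → UnitAddTorus (Fin 3) → EuclideanSpace ℝ (Fin 3))
    (u : ℕ → ℝ → UnitAddTorus (Fin 3) → EuclideanSpace ℝ (Fin 3)) (U : ℕ → ℝ → energySpace (Fin 3)),
    (∀ j, 0 < ν j) ∧ (∀ j, IsGlobalLerayHopf (ν j) (fun _ => tgForce) (u₀ j) (u j)) ∧ (∀ j, IsLift (u j) (U j)) ∧
    (∀ j, IsKSymmLift (U j)) ∧ ∀ j, meanEnergy (u j) ≤ E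

/-- **Dropping `ν_j → 0` makes B_K a theorem** (`ν ≡ 1`, the `K`-symmetric rest family, `E = 2`): the vanishing-viscosity
clause carries the ENTIRE content — ν-UNIFORMITY of one number. -/
theorem withoutVanishing_holds : BWithoutVanishing := by
  obtain ⟨u, V, hu, hV, hK, hE⟩ := perViscosity_ceiling 1 one_pos
  exact ⟨2 / 1 ^ 2, fun _ => 1, fun _ => 0, fun _ => u, fun _ => V, fun _ => one_pos, fun _ => hu, fun _ => hV,
    fun _ => hK, fun _ => hE⟩


/-! ## §4 Strengthen (ii)–(iv): rest ceilings, trajectory-blind ceilings, the relative floor -/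

/-- **S7-TG / birth-line content `StubMirrorMeanCeilingFromRestTG` (∀-rest MEAN ceiling).** Some level `E` bounds the
limsup-mean energy of EVERY `K`-symmetric lifted Leray–Hopf solution of NS_ν(f_TG) FROM REST, for all `ν < ν₁`. -/
def MirrorMeanCeilingFromRestTG : Prop :=
  ∃ E ν₁ : ℝ, 0 < ν₁ ∧ ∀ ν : ℝ, 0 < ν → ν < ν₁ →
    ∀ (u : ℝ → UnitAddTorus (Fin 3) → EuclideanSpace ℝ (Fin 3)) (U : ℝ → energySpace (Fin 3)),
      IsGlobalLerayHopf ν (fun _ => tgForce) 0 u → IsLift u U → IsKSymmLift U → meanEnergy u ≤ E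

/-- **The birth line composes** (`StubMirrorLhFromRestTG` is `mirrorLhFromRest_holds`, so only the ceiling is left):
`MirrorMeanCeilingFromRestTG → B_K` along `ν_j = ν₁/(j+2)`. -/
theorem crux_of_meanCeilingFromRest (h : MirrorMeanCeilingFromRestTG) : B := by
  rw [crux_iff]
  obtain ⟨E, ν₁, hν₁, hall⟩ := h
  have hνj : ∀ j : ℕ, 0 < ν₁ / ((j : ℝ) + 2) ∧ ν₁ / ((j : ℝ) + 2) < ν₁ := fun j =>
    ⟨by positivity, by
      rw [div_lt_iff₀ (by positivity)]
      nlinarith [(Nat.cast_nonneg j : (0 : ℝ) ≤ j)]⟩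
  choose u U hLH hU hK using fun j : ℕ => mirrorLhFromRest_holds (ν₁ / ((j : ℝ) + 2)) (hνj j).1
  have hν0 : Tendsto (fun j : ℕ => ν₁ / ((j : ℝ) + 2)) atTop (nhds 0) := by
    have h1 : Tendsto (fun j : ℕ => ((j : ℝ) + 2)) atTop atTop :=
      tendsto_atTop_add_const_right _ _ tendsto_natCast_atTop_atTop
    simpa using tendsto_const_nhds.div_atTop h1
  exact ⟨E, fun j => ν₁ / ((j : ℝ) + 2), fun _ => 0, u, U, ⟨fun j => (hνj j).1, hν0, hLH, hU, hK⟩,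
    fun j => hall _ (hνj j).1 (hνj j).2 (u j) (U j) (hLH j) (hU j) (hK j)⟩

/-- **Trajectory-blind `K`-ceiling (∀ data).** Some level bounds the limsup-mean energy of EVERY `K`-symmetric lifted
Leray–Hopf solution of NS_ν(f_TG), any datum, all `ν < ν₁` — what an absorbing-ball / Lyapunov / auxiliary-functional
(background, SOS) argument would prove if it proved anything ν-uniform.  NUMERICALLY FALSE in Fix K: the hub's steady
`K`-branches of NS_ν(f_TG) (Newton census, route MirrorVariety) have `E ≍ ν^{-0.7…-0.8}`, and a steady state is its own
time average.  Not refutable in Lean today (no rigorous warm steady `K`-state); recorded because it shows that B_K's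
content is a statement about the SELECTED (rest / physical) statistics, not about the invariant set. -/
def MirrorMeanCeilingAllDataTG : Prop :=
  ∃ E ν₁ : ℝ, 0 < ν₁ ∧ ∀ ν : ℝ, 0 < ν → ν < ν₁ →
    ∀ (u₀ : UnitAddTorus (Fin 3) → EuclideanSpace ℝ (Fin 3)) (u : ℝ → UnitAddTorus (Fin 3) → EuclideanSpace ℝ (Fin 3))
      (U : ℝ → energySpace (Fin 3)),
      IsGlobalLerayHopf ν (fun _ => tgForce) u₀ u → IsLift u U → IsKSymmLift U → meanEnergy u ≤ E

/-- Trajectory-blind ⟹ rest ceiling (specialise the datum). -/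
theorem meanCeilingFromRest_of_allData (h : MirrorMeanCeilingAllDataTG) : MirrorMeanCeilingFromRestTG := by
  obtain ⟨E, ν₁, hν₁, hall⟩ := h
  exact ⟨E, ν₁, hν₁, fun ν hν hνlt u U hu hU hK => hall ν hν hνlt 0 u U hu hU hK⟩

/-- **Doering–Foias power budget at f_TG**: `ε = ⟨ν‖∇u‖²⟩ ≤ ⟨(f_TG,u)⟩ ≤ ‖f_TG‖₂·U = √(1/4)·√(meanEnergy u)` for every
global Leray–Hopf solution of NS_ν(f_TG), `ν > 0`, any datum (landed chain `DoeringFoias2002_dissipation_le_power_holds`,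
`IsGlobalLerayHopf.meanPower_le`, `integral_norm_sq_tgForce`). -/
theorem meanDissipation_le_tg {ν : ℝ} (hν : 0 < ν) {u₀ : UnitAddTorus (Fin 3) → EuclideanSpace ℝ (Fin 3)}
    {u : ℝ → UnitAddTorus (Fin 3) → EuclideanSpace ℝ (Fin 3)} (hu : IsGlobalLerayHopf ν (fun _ => tgForce) u₀ u) :
    meanDissipation ν u ≤ Real.sqrt 4⁻¹ * Real.sqrt (meanEnergy u) := by
  have h1 : meanDissipation ν u ≤ meanPower tgForce u :=
    DoeringFoias2002_dissipation_le_power_holds hν (isSmooth_tgForce.memLp 2) hasZeroMean_tgForce u₀ u hu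
  have h2 := hu.meanPower_le hν isSmooth_tgForce hasZeroMean_tgForce
  rw [rmsVelocity_eq_sqrt_meanEnergy, integral_norm_sq_tgForce] at h2
  exact h1.trans h2

/-- **S⁺_rel (relative floor) in Fix K.** SOME `K`-family pays dissipation proportional to its own mean energy,
`c·meanEnergy(u_j) ≤ meanDissipation(ν_j,u_j)` (mean enstrophy/energy `≥ c/ν_j`: Taylor microscale `≲ √ν_j`, the K41
expectation; `c ≈ ε/E ≈ 0.25/0.45 ≈ 0.55` in the hub's K-census). -/
def RelativeFloorFamilyTG (c : ℝ) : Prop :=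
  ∃ (ν : ℕ → ℝ) (u₀ : ℕ → UnitAddTorus (Fin 3) → EuclideanSpace ℝ (Fin 3))
    (u : ℕ → ℝ → UnitAddTorus (Fin 3) → EuclideanSpace ℝ (Fin 3)) (U : ℕ → ℝ → energySpace (Fin 3)),
    IsKFamily ν u₀ u U ∧ ∀ j, c * meanEnergy (u j) ≤ meanDissipation (ν j) (u j)

/-- A relative floor caps the mean energy: `c·E ≤ ε ≤ √(1/4)·√E` forces `E ≤ 4⁻¹/c²`. -/
theorem meanEnergy_le_of_relativeFloor {c ν : ℝ} (hc : 0 < c) (hν : 0 < ν)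
    {u₀ : UnitAddTorus (Fin 3) → EuclideanSpace ℝ (Fin 3)} {u : ℝ → UnitAddTorus (Fin 3) → EuclideanSpace ℝ (Fin 3)}
    (hu : IsGlobalLerayHopf ν (fun _ => tgForce) u₀ u) (h : c * meanEnergy u ≤ meanDissipation ν u) :
    meanEnergy u ≤ 4⁻¹ / c ^ 2 := by
  have hE0 : 0 ≤ meanEnergy u := meanEnergy_nonneg u
  have key : c * meanEnergy u ≤ Real.sqrt 4⁻¹ * Real.sqrt (meanEnergy u) := h.trans (meanDissipation_le_tg hν hu)
  have hsq : Real.sqrt (meanEnergy u) ^ 2 = meanEnergy u := Real.sq_sqrt hE0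
  have hs0 : 0 ≤ Real.sqrt (meanEnergy u) := Real.sqrt_nonneg _
  have ha0 : 0 ≤ Real.sqrt 4⁻¹ := Real.sqrt_nonneg _
  have h1 : c * Real.sqrt (meanEnergy u) ≤ Real.sqrt 4⁻¹ := by
    by_cases h0 : Real.sqrt (meanEnergy u) = 0
    · rw [h0, mul_zero]; exact ha0
    · have hpos : 0 < Real.sqrt (meanEnergy u) := lt_of_le_of_ne hs0 (Ne.symm h0)
      have h3 : c * Real.sqrt (meanEnergy u) * Real.sqrt (meanEnergy u) ≤
          Real.sqrt 4⁻¹ * Real.sqrt (meanEnergy u) := by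
        have h4 : c * Real.sqrt (meanEnergy u) ^ 2 ≤ Real.sqrt 4⁻¹ * Real.sqrt (meanEnergy u) := by
          rw [hsq]; exact key
        nlinarith [h4]
      exact le_of_mul_le_mul_right h3 hpos
  have h2 : Real.sqrt (meanEnergy u) ≤ Real.sqrt 4⁻¹ / c := by
    rw [le_div_iff₀ hc]; linarith
  calc meanEnergy u = Real.sqrt (meanEnergy u) ^ 2 := hsq.symm
    _ ≤ (Real.sqrt 4⁻¹ / c) ^ 2 := pow_le_pow_left₀ hs0 h2 2
    _ = 4⁻¹ / c ^ 2 := by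
        rw [div_pow, Real.sq_sqrt (by norm_num : (0 : ℝ) ≤ 4⁻¹)]

/-- **S⁺_rel → B_K** (level `E = 4⁻¹/c²`). -/
theorem crux_of_relativeFloor {c : ℝ} (hc : 0 < c) (h : RelativeFloorFamilyTG c) : B := by
  rw [crux_iff]
  obtain ⟨ν, u₀, u, U, hfam, hrel⟩ := h
  exact ⟨4⁻¹ / c ^ 2, ν, u₀, u, U, hfam, fun j =>
    meanEnergy_le_of_relativeFloor hc (hfam.1 j) (hfam.2.2.1 j) (hrel j)⟩

/-! ### The Doering–Foias level floor at f_TG (shape `2 f_TG`, amplitude `F = 1/2`) -/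

/-- The Doering–Foias forcing shape of the Taylor–Green force: `Φ_TG = 2 f_TG` (`‖f_TG‖₂² = 1/4`). -/
def tgShape : ForcingShape (Fin 3) where
  shape := (2 : ℝ) • tgForce
  smooth := isSmooth_tgForce.smul _
  divFree := Torus.isDivFree_const_smul (isSmooth_tgForce.isContDiff (by simp)) isDivFree_tgForce _
  zeroMean := Torus.hasZeroMean_const_smul hasZeroMean_tgForce _
  sq_norm_eq_one := by
    have h : ∀ x, ‖((2 : ℝ) • tgForce) x‖ ^ 2 = 4 * ‖tgForce x‖ ^ 2 := fun x => by
      rw [Pi.smul_apply, norm_smul, mul_pow, Real.norm_eq_abs]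
      norm_num
    simp_rw [h]
    rw [integral_const_mul, integral_norm_sq_tgForce]
    norm_num

/-- `f_TG = F Φ_TG`, `F = 1/2`, scale `ℓ = 1`. -/
theorem tgShape_force_one : tgShape.force 1 (2⁻¹ : ℝ) = tgForce := by
  funext x
  simp only [ForcingShape.force, tgShape, one_nsmul, Pi.smul_apply, smul_smul]
  norm_num

/-- **LEVEL FLOOR at f_TG (Doering–Foias momentum test).** There is `e₀ > 0` with `e₀ ≤ meanEnergy u` for every global
Leray–Hopf solution of NS_ν(f_TG), `0 < ν ≤ 1`, any datum, any symmetry: `|F| ≤ C U² + ν K U` with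
`U = (meanEnergy u)^{1/2}` forces `U ≥ min(1, F/(C+K+1))` (`DoeringFoias.abs_amplitude_le_of_isGlobalLerayHopf`,
the same proof as the landed GP level floor `GPMeanBoundedFamily/Negative/LevelFloor`).  First typed TG level floor
for Leray–Hopf PATHS (the landed `PumpedMirrorMirrorFloorTGSmallEnergy` facts are ensemble-level). -/
theorem exists_meanEnergy_floor_tg :
    ∃ e₀ : ℝ, 0 < e₀ ∧ ∀ (ν : ℝ) (u₀ : UnitAddTorus (Fin 3) → EuclideanSpace ℝ (Fin 3))
      (u : ℝ → UnitAddTorus (Fin 3) → EuclideanSpace ℝ (Fin 3)),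
      0 < ν → ν ≤ 1 → IsGlobalLerayHopf ν (fun _ => tgForce) u₀ u → e₀ ≤ meanEnergy u := by
  obtain ⟨M, hM0, hM⟩ := exists_norm_laplacian_force_le tgShape
  obtain ⟨D, hD0, hD⟩ := exists_sum_norm_partialDeriv_comp_nsmul_le tgShape
  set F : ℝ := 2⁻¹ with hF
  have hFpos : 0 < F := by norm_num
  have hS : 0 < D + M + 1 := by linarith
  set U₀ : ℝ := min 1 (F / (D + M + 1)) with hU₀
  have hU₀pos : 0 < U₀ := lt_min one_pos (div_pos hFpos hS)
  refine ⟨U₀ ^ 2, pow_pos hU₀pos 2, fun ν u₀ u hν hν1 hu => ?_⟩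
  have hu' : IsGlobalLerayHopf ν (fun _ => tgShape.force 1 F) u₀ u := by rwa [tgShape_force_one]
  have hCΨ : ∀ x, ∑ i, ‖Torus.partialDeriv i (tgShape.force 1 1) x‖ ≤ D := fun x => by
    rw [force_one_eq]; simpa using hD 1 x
  have hL : ∀ x, ‖Torus.laplacian (tgShape.force 1 1) x‖ ≤ M := fun x => by simpa using hM 1 1 x
  have key := DoeringFoias.abs_amplitude_le_of_isGlobalLerayHopf hν one_pos hu' hD0 hM0 hCΨ hL
  set V := rmsVelocity longTimeAvgSup u with hV
  have hVdef : V = Real.sqrt (meanEnergy u) := rfl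
  have hV0 : 0 ≤ V := Real.sqrt_nonneg _
  have hE0 : 0 ≤ meanEnergy u := meanEnergy_nonneg u
  rw [abs_of_pos hFpos] at key
  by_contra hcon
  have hlt : meanEnergy u < U₀ ^ 2 := lt_of_not_ge hcon
  have hUlt : V < U₀ := by
    rw [hVdef]
    calc Real.sqrt (meanEnergy u) < Real.sqrt (U₀ ^ 2) := Real.sqrt_lt_sqrt hE0 hlt
      _ = U₀ := Real.sqrt_sq hU₀pos.le
  have hU1 : V ≤ 1 := (hUlt.le.trans (min_le_left _ _))
  have hUF : V < F / (D + M + 1) := hUlt.trans_le (min_le_right _ _)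
  have h1 : D * V ^ 2 ≤ D * V := by
    have : V ^ 2 ≤ V := by nlinarith
    exact mul_le_mul_of_nonneg_left this hD0
  have h2 : ν * M * V ≤ M * V := by
    have : ν * M ≤ M := by nlinarith
    exact mul_le_mul_of_nonneg_right this hV0
  have h3 : (D + M + 1) * V < F := by
    have := (lt_div_iff₀ hS).mp hUF
    linarith [this]
  nlinarith [key, h1, h2, h3, hV0]

/-- **Every witness level of B_K is at least `e₀`** (uses only the first path of the family past the index where
`ν_j ≤ 1`; the symmetric rest census of the hub puts the true level near `0.45`). -/
theorem witness_level_ge {E : ℝ} {ν : ℕ → ℝ} {u₀ : ℕ → UnitAddTorus (Fin 3) → EuclideanSpace ℝ (Fin 3)}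
    {u : ℕ → ℝ → UnitAddTorus (Fin 3) → EuclideanSpace ℝ (Fin 3)} {U : ℕ → ℝ → energySpace (Fin 3)}
    (hfam : IsKFamily ν u₀ u U) (hE : ∀ j, meanEnergy (u j) ≤ E) :
    ∃ e₀ : ℝ, 0 < e₀ ∧ e₀ ≤ E := by
  obtain ⟨e₀, he₀, hfloor⟩ := exists_meanEnergy_floor_tg
  obtain ⟨hν, hν0, hLH, -, -⟩ := hfam
  obtain ⟨J, hJ⟩ := Filter.eventually_atTop.1 (hν0.eventually (gt_mem_nhds one_pos))
  exact ⟨e₀, he₀, (hfloor (ν J) (u₀ J) (u J) (hν J) (hJ J le_rfl).le (hLH J)).trans (hE J)⟩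

/-- **S⁺_rel → X_K (the route's TARGET, summit-strength in the arena).**  With the level floor the relative floor is an
ABSOLUTE floor `ε_j ≥ c·e₀` once `ν_j ≤ 1`, and `crux_of_relativeFloor` bounds the energies: so the only multiplicative
strengthening of B_K that the energy inequality can use is already the zeroth law in Fix K — it buys nothing short of
the summit. -/
theorem target_of_relativeFloor {c : ℝ} (hc : 0 < c) (h : RelativeFloorFamilyTG c) : X := by
  intro f hf
  have hfg : f = tgForce := hf.trans tgForce_eq.symm
  subst hfg
  obtain ⟨ν, u₀, u, U, ⟨hν, hν0, hLH, hU, hK⟩, hrel⟩ := h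
  obtain ⟨e₀, he₀, hfloor⟩ := exists_meanEnergy_floor_tg
  -- drop the finitely many indices with `ν_j > 1`
  obtain ⟨J, hJ⟩ := Filter.eventually_atTop.1 (hν0.eventually (gt_mem_nhds one_pos))
  have hEj : ∀ j, meanEnergy (u (j + J)) ≤ 4⁻¹ / c ^ 2 := fun j =>
    meanEnergy_le_of_relativeFloor hc (hν (j + J)) (hLH (j + J)) (hrel (j + J))
  have hεj : ∀ j, c * e₀ ≤ meanDissipation (ν (j + J)) (u (j + J)) := fun j => by
    have hfl : e₀ ≤ meanEnergy (u (j + J)) :=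
      hfloor (ν (j + J)) (u₀ (j + J)) (u (j + J)) (hν (j + J)) (hJ (j + J) (Nat.le_add_left J j)).le (hLH (j + J))
    calc c * e₀ ≤ c * meanEnergy (u (j + J)) := mul_le_mul_of_nonneg_left hfl hc.le
      _ ≤ meanDissipation (ν (j + J)) (u (j + J)) := hrel (j + J)
  exact ⟨4⁻¹ / c ^ 2, c * e₀, mul_pos hc he₀, fun j => ν (j + J), fun j => u₀ (j + J), fun j => u (j + J),
    fun j => U (j + J), fun j => hν (j + J), hν0.comp (tendsto_add_atTop_nat J), fun j => hLH (j + J),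
    fun j => hU (j + J), fun j => hK (j + J), hEj, hεj⟩

/-- Converse: X_K gives a relative floor (`c = ε / max E 1`), so S⁺_rel ⟺ X_K ⟹ B_K. -/
theorem relativeFloor_of_target (h : X) : ∃ c : ℝ, 0 < c ∧ RelativeFloorFamilyTG c := by
  obtain ⟨E, ε, hε, ν, u₀, u, U, hν, hν0, hLH, hU, hK, hE, hεj⟩ := h tgForce tgForce_eq
  set E' : ℝ := max E 1 with hE'
  have hE'pos : 0 < E' := lt_of_lt_of_le one_pos (le_max_right _ _)
  refine ⟨ε / E', div_pos hε hE'pos, ν, u₀, u, U, ⟨hν, hν0, hLH, hU, hK⟩, fun j => ?_⟩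
  have hEj : meanEnergy (u j) ≤ E' := (hE j).trans (le_max_left _ _)
  calc ε / E' * meanEnergy (u j) ≤ ε / E' * E' := mul_le_mul_of_nonneg_left hEj (div_pos hε hE'pos).le
    _ = ε := div_mul_cancel₀ ε hE'pos.ne'
    _ ≤ meanDissipation (ν j) (u j) := hεj j

/-! ## §5 Decomposition -/

/-! ### (a) The ensemble mean split in Fix K (thin seam) -/

/-- The mirror set of `H` (coordinatewise a.e. `K`-symmetry of the representative), as in the route decls. -/
def mirrorSet : Set (energySpace (Fin 3)) :=
  {v : energySpace (Fin 3) | ∀ i i' : Fin 3, (fun x => ((v : Lp (EuclideanSpace ℝ (Fin 3)) 2 (volume : Measure (UnitAddTorus (Fin 3)))) :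
      UnitAddTorus (Fin 3) → EuclideanSpace ℝ (Fin 3)) (Function.update x i (-x i)) i') =ᵐ[volume]
    (fun x => if i' = i then -(((v : Lp (EuclideanSpace ℝ (Fin 3)) 2 (volume : Measure (UnitAddTorus (Fin 3)))) :
      UnitAddTorus (Fin 3) → EuclideanSpace ℝ (Fin 3)) x i') else ((v : Lp (EuclideanSpace ℝ (Fin 3)) 2
        (volume : Measure (UnitAddTorus (Fin 3)))) : UnitAddTorus (Fin 3) → EuclideanSpace ℝ (Fin 3)) x i')}

/-- **Sub₁ (ensemble form of B_K).** Along some `ν_j → 0` there are FMRT stationary statistical solutions `μ_j` of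
NS_{ν_j}(f_TG) carried by `closure (Fix K)` with integrable and ν-UNIFORMLY bounded ensemble energy.  (The only known
supplies are time averages of the very families B_K asks for, and K-symmetric Galerkin invariant measures with the same
unknown bound; at each ν it is EQUIVALENT to "no K-restricted cylindrical energy certificate beats E" by the
Bronzi–Mondaini–Rosa minimax — census §T5/§N3.) -/
def MirrorEnsembleMeanBoundedFamilyTG : Prop :=
  ∃ (E : ℝ) (ν : ℕ → ℝ) (μ : ℕ → Measure (energySpace (Fin 3))),
    (∀ j, 0 < ν j) ∧ Tendsto ν atTop (nhds 0) ∧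
      ∀ j, IsStationaryStatisticalSolution (ν j) tgForce (μ j) ∧
        Integrable (fun v : energySpace (Fin 3) => ‖v‖ ^ 2) (μ j) ∧ ensembleEnergy (μ j) ≤ E ∧ μ j (closure mirrorSet)ᶜ = 0

/-- **Sub₂ (mean realisation in Fix K).** At fixed `ν > 0`, a K-supported FMRT stationary statistical solution of
NS_ν(f_TG) with ensemble energy `≤ E` is accompanied, for every `δ > 0`, by ONE K-symmetric lifted global Leray–Hopf
path with limsup-mean energy `≤ E + δ`.  Theorem-type for Dirac masses at steady states and for time-average /
Vishik–Fursikov measures (ergodic decomposition + Birkhoff; Foias–Rosa–Temam 2019 §§4.2–4.3); OPEN for a general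
Foias–Prodi measure in `d = 3`. -/
def MirrorMeanRealisationTG : Prop :=
  ∀ (ν E δ : ℝ) (μ : Measure (energySpace (Fin 3))), 0 < ν → 0 < δ →
    IsStationaryStatisticalSolution ν tgForce μ → Integrable (fun v : energySpace (Fin 3) => ‖v‖ ^ 2) μ →
    ensembleEnergy μ ≤ E → μ (closure mirrorSet)ᶜ = 0 →
      ∃ (u₀ : UnitAddTorus (Fin 3) → EuclideanSpace ℝ (Fin 3)) (u : ℝ → UnitAddTorus (Fin 3) → EuclideanSpace ℝ (Fin 3))
        (U : ℝ → energySpace (Fin 3)),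
        IsGlobalLerayHopf ν (fun _ => tgForce) u₀ u ∧ IsLift u U ∧ IsKSymmLift U ∧ meanEnergy u ≤ E + δ

/-- **The ensemble split composes** (`δ = 1`): `Sub₁ → Sub₂ → B_K`, a choice along `j` — the seam is THIN: all the
ν-uniformity lives in Sub₁, which is B_K in ensemble dress. -/
theorem crux_of_ensembleSplit (h₁ : MirrorEnsembleMeanBoundedFamilyTG) (h₂ : MirrorMeanRealisationTG) : B := by
  rw [crux_iff]
  obtain ⟨E, ν, μ, hν, hν0, hμ⟩ := h₁
  choose u₀ u U hLH hlift hK hbd using fun j =>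
    h₂ (ν j) E 1 (μ j) (hν j) one_pos (hμ j).1 (hμ j).2.1 (hμ j).2.2.1 (hμ j).2.2.2
  exact ⟨E + 1, ν, u₀, u, U, ⟨hν, hν0, hLH, hlift, hK⟩, hbd⟩

/-! ### (b) The Galerkin–Cesàro reduction (weakest finite-dimensional sufficient form; registration-ready, NOT registered) -/

/-- **B″ — ν-uniform, resolution-uniform CESÀRO ceiling for the K-symmetric Taylor–Green Galerkin flow from rest, along
SOME sequence of viscosities (liminf form).**  There is `E` such that below every `ν₁ > 0` some viscosity `ν` has a
resolution threshold `N₀` and a time `T₀` beyond which EVERY exact-force `K`-symmetric Hopf–Galerkin scheme for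
`(ν, f_TG, 0)` has running-mean energy `T⁻¹∫₀ᵀ∫|U n t|² ≤ E` for all `T ≥ T₀` at every order `N n ≥ N₀`.
Strictly weaker than PumpedMirror's registered pathwise stub B′₂ (`galerkinCesaro_of_pathwiseLate`); the thresholds
`N₀(ν)` (order 2 is the laminar ray, energy `‖f_TG‖²/(144π⁴ν²)`) and `T₀(ν)` are necessary and harmless. -/
def GalerkinCesaroCeilingFromRestTG : Prop :=
  ∀ f : UnitAddTorus (Fin 3) → EuclideanSpace ℝ (Fin 3), f = (fun x => !₂[(fourier 1 (x 0) : ℂ).im * (fourier 1 (x 1) : ℂ).re * (fourier 1 (x 2) : ℂ).re, -((fourier 1 (x 0) : ℂ).re * (fourier 1 (x 1) : ℂ).im * (fourier 1 (x 2) : ℂ).re), (0 : ℝ)]) →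
    ∃ E : ℝ, ∀ ν₁ : ℝ, 0 < ν₁ → ∃ ν : ℝ, 0 < ν ∧ ν < ν₁ ∧ ∃ (N₀ : ℕ) (T₀ : ℝ), 0 ≤ T₀ ∧
      ∀ (N : ℕ → ℕ) (U : ℕ → ℝ → UnitAddTorus (Fin 3) → EuclideanSpace ℝ (Fin 3)),
        IsHopfGalerkinScheme ν (fun _ => f) 0 N (fun _ _ => f) U →
        (∀ (n : ℕ) (t : ℝ), 0 ≤ t → ∀ (i j : Fin 3) (x : UnitAddTorus (Fin 3)),
          U n t (Function.update x i (-x i)) j = if j = i then -(U n t x j) else U n t x j) →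
        ∀ n : ℕ, N₀ ≤ N n → ∀ T : ℝ, T₀ ≤ T → timeMean (fun t => ∫ x, ‖U n t x‖ ^ 2) T ≤ E

/-- **C″ — Cesàro bounds pass to a K-symmetric Leray–Hopf limit** (provable now, M/L: the landed
`stub_limitInheritsMirrorBound` with its Fatou–Parseval step replaced by Fatou IN TIME — for each slice
`∫|u t|² ≤ liminf ∫|U (φ j) t|²`, then `∫₀ᵀ` and `liminf` exchanged by Fatou; a non-integrable limit energy has junk
running mean `0 ≤ E`).  For `ν > 0`, a level `E`, a time `T₀ ≥ 0` and an exact-force scheme for `(ν, f_TG, 0)` with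
pointwise `K`-symmetric slices whose running means obey `T⁻¹∫₀ᵀ∫|U n t|² ≤ E` for all `n` and `T ≥ T₀`, there is a
global Leray–Hopf solution from rest with an `H`-lift, `K`-symmetric a.e., with `meanEnergy u ≤ E`. -/
def CesaroBoundPassesToMirrorLimitTG : Prop :=
  ∀ f : UnitAddTorus (Fin 3) → EuclideanSpace ℝ (Fin 3), f = (fun x => !₂[(fourier 1 (x 0) : ℂ).im * (fourier 1 (x 1) : ℂ).re * (fourier 1 (x 2) : ℂ).re, -((fourier 1 (x 0) : ℂ).re * (fourier 1 (x 1) : ℂ).im * (fourier 1 (x 2) : ℂ).re), (0 : ℝ)]) →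
    ∀ (ν E T₀ : ℝ), 0 < ν → 0 ≤ T₀ →
      ∀ (N : ℕ → ℕ) (U : ℕ → ℝ → UnitAddTorus (Fin 3) → EuclideanSpace ℝ (Fin 3)),
        IsHopfGalerkinScheme ν (fun _ => f) 0 N (fun _ _ => f) U →
        (∀ (n : ℕ) (t : ℝ), 0 ≤ t → ∀ (i j : Fin 3) (x : UnitAddTorus (Fin 3)),
          U n t (Function.update x i (-x i)) j = if j = i then -(U n t x j) else U n t x j) →
        (∀ (n : ℕ) (T : ℝ), T₀ ≤ T → timeMean (fun t => ∫ x, ‖U n t x‖ ^ 2) T ≤ E) →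
        ∃ (u : ℝ → UnitAddTorus (Fin 3) → EuclideanSpace ℝ (Fin 3)) (V : ℝ → energySpace (Fin 3)),
          IsGlobalLerayHopf ν (fun _ => f) 0 u ∧ IsLift u V ∧ IsKSymmLift V ∧ meanEnergy u ≤ E

/-- **The Galerkin–Cesàro line composes over the LANDED stub A** (`stub_mirrorSchemeFromRest`, p144899):
`C″ → B″ → B_K`.  For each `j` take a viscosity `ν_j < 1/(j+1)` from B″ with its thresholds, a K-symmetric exact-force
scheme from rest (A), its tail beyond `N₀` (a tail of a scheme is a scheme), the Cesàro ceiling along the tail (B″),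
and the K-symmetric Leray–Hopf limit with `meanEnergy ≤ E` (C″); `ν_j → 0` by squeezing. -/
theorem crux_of_galerkinCesaro (hC : CesaroBoundPassesToMirrorLimitTG) (hB : GalerkinCesaroCeilingFromRestTG) : B := by
  rw [crux_iff]
  obtain ⟨E, hE⟩ := hB tgForce tgForce_eq
  have key : ∀ j : ℕ, ∃ (ν : ℝ) (u : ℝ → UnitAddTorus (Fin 3) → EuclideanSpace ℝ (Fin 3)) (V : ℝ → energySpace (Fin 3)),
      0 < ν ∧ ν < 1 / ((j : ℝ) + 1) ∧ IsGlobalLerayHopf ν (fun _ => tgForce) 0 u ∧ IsLift u V ∧ IsKSymmLift V ∧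
      meanEnergy u ≤ E := fun j => by
    obtain ⟨ν, hν, hνlt, N₀, T₀, hT₀, hceil⟩ := hE (1 / ((j : ℝ) + 1)) (by positivity)
    -- a `K`-symmetric exact-force Hopf–Galerkin scheme from rest (landed stub A)
    obtain ⟨N, U, hS, hsym⟩ := stub_mirrorSchemeFromRest tgForce tgForce_eq ν hν
    -- its tail beyond the resolution threshold
    obtain ⟨n₀, hn₀⟩ := Filter.tendsto_atTop_atTop.1 hS.tendsto_order N₀
    have hφ : StrictMono (fun n : ℕ => n + n₀) := fun a b hab => Nat.add_lt_add_right hab n₀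
    have hS' : IsHopfGalerkinScheme ν (fun _ => tgForce) 0 (fun n => N (n + n₀)) (fun _ _ => tgForce)
        (fun n => U (n + n₀)) := hS.comp_strictMono hφ
    have hsym' : ∀ (n : ℕ) (t : ℝ), 0 ≤ t → ∀ (i j : Fin 3) (x : UnitAddTorus (Fin 3)),
        (fun n => U (n + n₀)) n t (Function.update x i (-x i)) j =
          if j = i then -((fun n => U (n + n₀)) n t x j) else (fun n => U (n + n₀)) n t x j :=
      fun n t ht i j x => hsym (n + n₀) t ht i j x
    -- the Cesàro ceiling along the tail
    have hces : ∀ (n : ℕ) (T : ℝ), T₀ ≤ T → timeMean (fun t => ∫ x, ‖(fun n => U (n + n₀)) n t x‖ ^ 2) T ≤ E :=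
      fun n T hT => hceil N U hS hsym (n + n₀) (hn₀ (n + n₀) (Nat.le_add_left n₀ n)) T hT
    obtain ⟨u, V, hu, hV, hK, hEu⟩ := hC tgForce tgForce_eq ν E T₀ hν hT₀ _ _ hS' hsym' hces
    exact ⟨ν, u, V, hν, hνlt, hu, hV, hK, hEu⟩
  choose ν u V hν hνlt hLH hV hK hEu using key
  have hν0 : Tendsto ν atTop (nhds 0) :=
    squeeze_zero (fun j => (hν j).le) (fun j => (hνlt j).le) tendsto_one_div_add_atTop_nhds_zero_nat
  exact ⟨E, ν, fun _ => 0, u, V, ⟨hν, hν0, hLH, hV, hK⟩, hEu⟩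

/-! ### (c) The live PumpedMirror line already carries a STRONGER Galerkin stub -/

/-- PumpedMirror's registered open stub B′₂ `stub_galerkinLateCeilingFromRest` (statement verbatim, lead c1 2026-08-17). -/
def GalerkinLateCeilingFromRestTG : Prop :=
  ∀ f : UnitAddTorus (Fin 3) → EuclideanSpace ℝ (Fin 3), f = (fun x => !₂[(fourier 1 (x 0) : ℂ).im * (fourier 1 (x 1) : ℂ).re * (fourier 1 (x 2) : ℂ).re, -((fourier 1 (x 0) : ℂ).re * (fourier 1 (x 1) : ℂ).im * (fourier 1 (x 2) : ℂ).re), (0 : ℝ)]) →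
    ∃ (E T₀ ν₁ : ℝ), 0 < E ∧ 0 ≤ T₀ ∧ 0 < ν₁ ∧ ∀ ν : ℝ, 0 < ν → ν < ν₁ → ∃ N₀ : ℕ,
      ∀ (N : ℕ → ℕ) (U : ℕ → ℝ → UnitAddTorus (Fin 3) → EuclideanSpace ℝ (Fin 3)),
        IsHopfGalerkinScheme ν (fun _ => f) 0 N (fun _ _ => f) U →
        (∀ (n : ℕ) (t : ℝ), 0 ≤ t → ∀ (i j : Fin 3) (x : UnitAddTorus (Fin 3)),
          U n t (Function.update x i (-x i)) j = if j = i then -(U n t x j) else U n t x j) →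
        ∀ n : ℕ, N₀ ≤ N n → ∀ t : ℝ, T₀ ≤ t → ∫ x, ‖U n t x‖ ^ 2 ≤ E

/-- Running means of a function squeezed into `[0, K]` on `(0, ∞)` are `≤ K` (`T > 0`). -/
theorem timeMean_le_const {g : ℝ → ℝ} {K T : ℝ} (hT : 0 < T) (hg0 : ∀ t, 0 ≤ g t) (hle : ∀ t, 0 < t → g t ≤ K) :
    timeMean g T ≤ K := by
  have hK : 0 ≤ K := (hg0 1).trans (hle 1 one_pos)
  have hmean : timeMean (fun _ => K) T = K := by
    unfold timeMean
    rw [intervalIntegral.integral_const, smul_eq_mul, sub_zero, ← mul_assoc, inv_mul_cancel₀ hT.ne', one_mul]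
  rw [← hmean]
  exact timeMean_mono_of_nonneg hT.le (fun _ => hK) (integrableOn_const (hs := measure_Ioc_lt_top.ne))
    fun t ht _ => hle t ht

/-- **B′₂ (pathwise, late) ⟹ B″ (Cesàro)**: with the landed ν-uniform transient `∫|U n t|² ≤ t²`
(`Transient.tg_galerkin_energy_le_sq`) the pathwise late ceiling bounds every slice by `max E T₀²`, hence every running
mean.  So the open content of PumpedMirror's live line implies the Galerkin–Cesàro ceiling, which (with C″) implies B_K:
no separate lead is needed for B_K while that line is alive. -/
theorem galerkinCesaro_of_pathwiseLate (h : GalerkinLateCeilingFromRestTG) : GalerkinCesaroCeilingFromRestTG := by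
  intro f hf
  obtain ⟨E, T₀, ν₁, hE, hT₀, hν₁, hall⟩ := h f hf
  subst hf
  refine ⟨max E (T₀ ^ 2), fun ν₁' hν₁' => ?_⟩
  set ν : ℝ := min ν₁ ν₁' / 2 with hνdef
  have hmin : 0 < min ν₁ ν₁' := lt_min hν₁ hν₁'
  have hν : 0 < ν := by positivity
  have hνlt : ν < ν₁' := by
    have : min ν₁ ν₁' ≤ ν₁' := min_le_right _ _
    rw [hνdef]; linarith
  have hνlt1 : ν < ν₁ := by
    have : min ν₁ ν₁' ≤ ν₁ := min_le_left _ _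
    rw [hνdef]; linarith
  obtain ⟨N₀, hN₀⟩ := hall ν hν hνlt1
  refine ⟨ν, hν, hνlt, N₀, 1, zero_le_one, fun N U hS hsym n hn T hT => ?_⟩
  refine timeMean_le_const (lt_of_lt_of_le one_pos hT) (fun t => integral_nonneg fun x => sq_nonneg _) fun t ht => ?_
  rcases le_or_gt T₀ t with hle | hlt
  · exact (hN₀ N U hS hsym n hn t hle).trans (le_max_left _ _)
  · calc ∫ x, ‖U n t x‖ ^ 2 ≤ t ^ 2 :=
          PumpedMirror.MirrorBoundedFromRestTG.Transient.tg_galerkin_energy_le_sq hν.le hS n ht.le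
      _ ≤ T₀ ^ 2 := by
          have ht0 : 0 ≤ t := ht.le
          nlinarith
      _ ≤ max E (T₀ ^ 2) := le_max_right _ _

/-! ## §6 Negation: what a disproof must deliver first -/

/-- **Universal divergence of the K-symmetric REST paths**: for every level `E` there is `ν₀ > 0` such that for all
`ν ∈ (0, ν₀)` EVERY global Leray–Hopf solution of NS_ν(f_TG) from rest with a `K`-symmetric `H`-lift has
`meanEnergy > E` (non-vacuous by `mirrorLhFromRest_holds`). -/
def RestFamilyDivergesTG : Prop :=
  ∀ E : ℝ, ∃ ν₀ : ℝ, 0 < ν₀ ∧ ∀ ν : ℝ, 0 < ν → ν < ν₀ →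
    ∀ (u : ℝ → UnitAddTorus (Fin 3) → EuclideanSpace ℝ (Fin 3)) (U : ℝ → energySpace (Fin 3)),
      IsGlobalLerayHopf ν (fun _ => tgForce) 0 u → IsLift u U → IsKSymmLift U → E < meanEnergy u

/-- **`¬B_K → RestFamilyDivergesTG`** (PROVED): a disproof must in particular show that the K-symmetric rest paths
overshoot every level at all small viscosities — the statement the hub's symmetric Taylor–Green runs contradict
(K-attractor means `E ≈ 0.43` at `ν = 0.002`, `0.48` at `ν = 0.001`).  Proof: otherwise one bounded rest path per
`ν₀ = 1/(j+1)` is a witness family. -/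
theorem restFamilyDiverges_of_not_crux (h : ¬ B) : RestFamilyDivergesTG := by
  by_contra hcon
  apply h
  rw [crux_iff]
  unfold RestFamilyDivergesTG at hcon
  push Not at hcon
  obtain ⟨E, hE⟩ := hcon
  have key : ∀ j : ℕ, ∃ (ν : ℝ) (u : ℝ → UnitAddTorus (Fin 3) → EuclideanSpace ℝ (Fin 3)) (U : ℝ → energySpace (Fin 3)),
      0 < ν ∧ ν < 1 / ((j : ℝ) + 1) ∧ IsGlobalLerayHopf ν (fun _ => tgForce) 0 u ∧ IsLift u U ∧ IsKSymmLift U ∧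
      meanEnergy u ≤ E := fun j => by
    obtain ⟨ν, hν, hνlt, u, U, hu, hU, hK, hEu⟩ := hE (1 / ((j : ℝ) + 1)) (by positivity)
    exact ⟨ν, u, U, hν, hνlt, hu, hU, hK, hEu⟩
  choose ν u U hν hνlt hLH hU hK hEu using key
  have hν0 : Tendsto ν atTop (nhds 0) :=
    squeeze_zero (fun j => (hν j).le) (fun j => (hνlt j).le) tendsto_one_div_add_atTop_nhds_zero_nat
  exact ⟨E, ν, fun _ => 0, u, U, ⟨hν, hν0, hLH, hU, hK⟩, hEu⟩

end Summit.AnomalousDissipation.AnomalousDissipation.Cruxes.MirrorMeanBoundedFamilyTG.StrategyCensus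

end
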